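import Summits.QuantumFields.YangMills.Theorems.BalabanUVNodesK0AllTorusOfStepTokensRCubeB
import Summits.QuantumFields.YangMills.Theorems.BalabanUVNodesK0GenericCubeOfStepTokensRB
import Summits.QuantumFields.YangMills.Theorems.BalabanUVNodesK0V23Stub3ComparabilitySuppliers

/-!
# K0⁷ — THE STAGE-2 SEAM DISCHARGED: hypothesis-free-in-the-seam editions of the ∀F K0 compositions of the Stage-2 siblings (`…K0AllTorusOfStepTokensRCubeB`, `…K0GenericCubeOfStepTokensRB`,
# `…K0AllTorusOfStepTokensRFloorB`) and of the V23 comparability road (`…K0V23Stub3ComparabilitySuppliers`)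

Cell `pub-ymgap`, seat `pub-ymgap-k0-s1-w3` (g9; dag-lead g34 PLACEMENT 1 (2) «STAGE (not file) the post-seam hypothesis-free corollaries …; file only after R549 TRAIN COMPLETE + GREEN»).
`--kind proof --supports stmt-QuantumFields-20541 --as helper`, COUNT-NEUTRAL.  NEW leaf; theorems only — 0 `def`, 0 `sorry`.  Imports the three sibling∕V23 modules above (all green,
route-free).  POST-SEAM ONLY: `hseam_holds` is `rfl` on node00-def-R's campaign row-1 text of `Node00/Record13CoP.lean` (`UbgOfRecord₁₃CoP F N θ p (n+1) := UbgMSCoPOfRecordB F N θ.ν θ.τ9.M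
(gOfRecord₁₃ F N θ p) p.K (n+1)`, [P2] (2.3) p.224 datum); before row 1 lands this file does NOT elaborate (then `UbgOfRecord₁₃CoP_succ` names the (b) map) — and is not filed.

CONTENTS.  `hseam_holds` (the seam, pointwise, `rfl`); then, for each displayed-seam composition `X (hseam) (h…) : ∀ F, ⁷-body F` of the four modules, `X_seamFree (h…) : ∀ F, ⁷-body F :=
X hseam_holds h…` — statements byte-identical to the originals minus the `hseam` binder: `record13SepCoPHBody_of_stubs123A_seamFree`, `stub4_of_stubs123A_seamFree`,
`record13SepCoPHBody_of_stubs12_jetsFreePair_allTorus_seamFree` (cube letter), `record13SepCoPHBody_of_stub1_of_gauge9Supplier_of_absBetaBoxAt_seamFree`, `record13SepCoPHBody_of_stubs123A_seamFree'`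
(generic cube letter), `record13SepCoPHBody_of_stub1R_of_gauge9SupplierR_of_absBetaBoxAtR_seamFree` (floor road, `hDat` still displayed), `k0Body_of_twoComparableZB_byName_seamFree`,
★ `k0Body_of_seam_of_twoComparableZB_seamFree` (K0⁷'s body at EVERY family from the COMPARABILITY CORE ALONE — stub 1ᴮ proved, 2′ discharged, seam discharged).

HONEST FRAMING (binding).  Kernel bookkeeping BY NAME; every corollary stays CONDITIONAL on its displayed stub texts ∕ cores (stub 1 = N07's [15] Prop. 8 top step where displayed, stub 2 = [6]
Prop. 6, 3ᴬ ∕ 3ᴬ′ ∕ jets-free pair ∕ comparability core = NODE O's wall: [I] §1 p.264 «uniformly bounded» STATED, proof unpublished [II] p.355) — inhabited nowhere here; nothing of Bałaban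
asserted or discharged; K0⁷ stmt-QuantumFields-20541 NOT closed; V23 NOT registered by this file; COUNT · K UNMOVED; one finite 𝕋⁴ programme at fixed ε — R4 closes only the conditional rung
`BalabanLadder.UV`; NOT continuum ∕ ℝ⁴ ∕ OS; the Yang–Mills mass gap (Clay) is NOT proved by any of this.  [I] = [Balaban1987RG1]; [II] = [Balaban1989LargeFieldII]; [P2] = [Balaban1984PropagatorsII].
-/

noncomputable section

open scoped Matrix.Norms.L2Operator
open Literature.MathematicalPhysics.QuantumFieldTheory.Balaban1983to89
open Literature.MathematicalPhysics.QuantumFieldTheory.Balaban1983to89.Node00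
open Literature.MathematicalPhysics.QuantumFieldTheory.Balaban1983to89.T4Continuum
open Literature.MathematicalPhysics.QuantumFieldTheory.Balaban1983to89.FlowStep
open Literature.MathematicalPhysics.QuantumFieldTheory.Balaban1983to89.Beta.Drift (OneLoopDrift)
open Summit.QuantumFields.BalabanUV.Gaps.BetaContFromD4Chain (AtSlopeCont)
open Summit.QuantumFields.YangMills.BalabanUVNodes.N07Thm1Top7FromProp8GuardedB (variationalThm1RegSepCoP7MGB_of_prop8TopStepGB_lamDatum)
open Summit.QuantumFields.YangMills.Theorems.K0ROfStepTokensRCubeB (shrunkCeiling_pos gauge9R_cube_of_prop8TopStep_of_prop6Member)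
open Summit.QuantumFields.YangMills.Theorems.K0SignFreeOfStepTokensRCubeB (clausesH_of_absBetaBox absBetaBox_of_jetsFreePair)
open Summit.QuantumFields.YangMills.Theorems.K0AllTorusOfStepTokensRFloorB (exists_k0SepCoPH_thm1CCMW_of_thm1RegSepCoP7MR_of_gauge9TopStepR_of_hcomp_allTorus)
open Summit.QuantumFields.YangMills.Theorems.K0ROfStepTokensRCubeB (shrunkCeiling_pos gauge9R_cube_of_prop8TopStep_of_prop6Member gauge9GB_cube_of_prop8TopStepGB_of_prop6Member)
open Summit.QuantumFields.YangMills.Theorems.BalabanUVNodesN26AtRecord13BetaBoxOfDriftAtSlope (exists_betaBox_betaOfRecord₁₃_of_jetsFreePair)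
open MeasureTheory
open Literature.MathematicalPhysics.QuantumFieldTheory.Balaban1983to89.FlowStepRuns
open Literature.MathematicalPhysics.QuantumFieldTheory.Balaban1983to89.B14.Eq218Concrete
open Literature.MathematicalPhysics.QuantumFieldTheory.Balaban1983to89.B15DeterminingSets
open Literature.MathematicalPhysics.QuantumFieldTheory.Balaban1983to89.B12RegularSpaces111
open Literature.MathematicalPhysics.QuantumFieldTheory.Balaban1983to89.B14RegularSpaces234
open Literature.MathematicalPhysics.QuantumFieldTheory.Balaban1983to89.B8LeafModelZd (ZdIdx)
open Literature.MathematicalPhysics.QuantumFieldTheory.Balaban1983to89.B8Prop6PrintedZdCubPGamma (prop6Printed_zdCubP_γ_holds_pos)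
open Summit.QuantumFields.YangMills.BalabanUVNodes.K0Stub1BHolds (prop8StepCoPGridGBAt_holds)
open Summit.QuantumFields.YangMills.Theorems.K0PrintCubeOfStepTokensGridGuardedB (gauge9SupplierG3B_of_prop6MemberP)
open Summit.QuantumFields.YangMills.Theorems.K0AllTorusOfStepTokensGuardedZBLam
open Summit.QuantumFields.YangMills.Theorems.K0V23Stub3RunwiseSuppliers

namespace Summit.QuantumFields.YangMills.Theorems.K0SeamFreeBodies

/-- **THE STAGE-2 SEAM, BY `rfl`** (node00-def-R campaign row 1, `Node00/Record13CoP.lean`: `UbgOfRecord₁₃CoP … (n+1) := UbgMSCoPOfRecordB …`; = `UbgOfRecord₁₃CoP_succ` read pointwise): the hypothesis `hseam` displayed by every K0 door of the Stage-2 siblings HOLDS. [cite: Balaban1988Convergent, Thm 1 p.262, (2.12)–(2.13) pp.256–257; Balaban1984PropagatorsII, (2.3) p.224] -/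
theorem hseam_holds : ∀ (F : T4Family) (θ : Stage13Params F 2) (p : B12.RunParams) (n : ℕ) (s : SeqOfRecord F θ.ν θ.τ9.M (gOfRecord₁₃ F 2 θ p) p.K (n + 1)) (W : B15DeterminingSets.MSField (F.P p.K) (SU 2)),
    UbgOfRecord₁₃CoP F 2 θ p (n + 1) s W = UbgMSCoPOfRecordB F 2 θ.ν θ.τ9.M (gOfRecord₁₃ F 2 θ p) p.K (n + 1) s W := fun _ _ _ _ _ _ => rfl

/-! ## From `K0AllTorusOfStepTokensRCubeB` -/

/-- **HYPOTHESIS-FREE IN THE SEAM**: `K0AllTorusOfStepTokensRCubeB.record13SepCoPHBody_of_stubs123A` with its displayed Stage-2 seam `hseam` DISCHARGED (`hseam_holds`, `rfl` post-seam); every other hypothesis unchanged and still DISPLAYED.  CONDITIONAL on them; K0⁷ NOT closed; nothing of Bałaban asserted. [cite: Balaban1988Convergent, Thm 1 p.262, (2.1) p.254, (2.12)–(2.13) pp.256–257; Balaban1985Variational, Thm 1 (8)–(9) p.279, Prop. 8 p.304; Balaban1987RG1, Thm 1 p.259, §1 p.264] -/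
theorem record13SepCoPHBody_of_stubs123A_seamFree
    (h1 : ∀ F : T4Family, ∃ B₃ a₀ a₁ : ℝ, 2 * (F.L : ℝ) ^ 2 ≤ B₃ ∧ 0 < a₀ ∧ 0 < a₁ ∧
      Prop8RegSepTopStepGB F 2 (fun ν K Ω => suppDomOfRecord F ν K Ω) (floorGuard F ((11 * 4 + 3 * F.L) * F.L)) (lamDatum F) (dataSmall7PTopOf F 2) B₃ a₀ a₁)
    (h2 : ∀ F : T4Family, ∃ B₁ c₁ : ℝ, 0 ≤ B₁ ∧ 0 < c₁ ∧
      (letI : CStarAlgebra (MatA 2) := {}; B8.Prop6Printed 4 (F.L : ℝ) B₁ c₁ (fun i : B8LeafModelZd.ZdIdx 4 F.L => zdCub (MatA 2) F.L i)))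
    (h3A : ∀ (F : T4Family) (B₃ B₃' a₀ a₁ : ℝ), 2 * (F.L : ℝ) ^ 2 ≤ B₃ → 0 < B₃' → 0 < a₀ → 0 < a₁ →
      VariationalThm1RegSepCoP7MGB F 2 (floorGuard F ((11 * 4 + 3 * F.L) * F.L)) (lamDatum F) (dataSmall7PTopOf F 2) B₃ a₀ a₁ →
      Gauge9RegSepTopStepGB F 2 (fun ν K Ω => suppDomOfRecord F ν K Ω) (F.L ^ 3) (floorGuard F ((11 * 4 + 3 * F.L) * F.L)) (lamDatum F) (dataSmall7PTopOf F 2) B₃ B₃' a₀ a₁ →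
      ∃ γ₀ ε₀ ε₂₉ β' : ℝ, 0 < γ₀ ∧ 0 < ε₀ ∧ 0 < ε₂₉ ∧
        BetaLowerH (-β') γ₀ (betaOfRecord₁₃ F 2 (theta13OfThm1CCM F 2 3 ε₀ ε₂₉ B₃ B₃' a₀ a₁)) ∧
        BetaUpperH β' γ₀ (betaOfRecord₁₃ F 2 (theta13OfThm1CCM F 2 3 ε₀ ε₂₉ B₃ B₃' a₀ a₁))) :
    ∀ F : T4Family, ∃ θ : Stage13HParams F 2, θ.Provisos₁₃SepCoPH F 2 ∧ (θ.ZhUnity F 2 ∧ θ.SlotsNondegenerate₁₃ F 2) ∧ θ.Admissible F 2 :=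
  Summit.QuantumFields.YangMills.Theorems.K0AllTorusOfStepTokensRCubeB.record13SepCoPHBody_of_stubs123A hseam_holds h1 h2 h3A

/-- **HYPOTHESIS-FREE IN THE SEAM**: `K0AllTorusOfStepTokensRCubeB.stub4_of_stubs123A` with its displayed Stage-2 seam `hseam` DISCHARGED (`hseam_holds`, `rfl` post-seam); every other hypothesis unchanged and still DISPLAYED.  CONDITIONAL on them; K0⁷ NOT closed; nothing of Bałaban asserted. [cite: Balaban1988Convergent, Thm 1 p.262, (2.1) p.254, (2.12)–(2.13) pp.256–257; Balaban1985Variational, Thm 1 (8)–(9) p.279, Prop. 8 p.304; Balaban1987RG1, Thm 1 p.259, §1 p.264] -/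
theorem stub4_of_stubs123A_seamFree
    (h1 : ∀ F : T4Family, ∃ B₃ a₀ a₁ : ℝ, 2 * (F.L : ℝ) ^ 2 ≤ B₃ ∧ 0 < a₀ ∧ 0 < a₁ ∧
      Prop8RegSepTopStepGB F 2 (fun ν K Ω => suppDomOfRecord F ν K Ω) (floorGuard F ((11 * 4 + 3 * F.L) * F.L)) (lamDatum F) (dataSmall7PTopOf F 2) B₃ a₀ a₁)
    (h2 : ∀ F : T4Family, ∃ B₁ c₁ : ℝ, 0 ≤ B₁ ∧ 0 < c₁ ∧
      (letI : CStarAlgebra (MatA 2) := {}; B8.Prop6Printed 4 (F.L : ℝ) B₁ c₁ (fun i : B8LeafModelZd.ZdIdx 4 F.L => zdCub (MatA 2) F.L i)))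
    (h3A : ∀ (F : T4Family) (B₃ B₃' a₀ a₁ : ℝ), 2 * (F.L : ℝ) ^ 2 ≤ B₃ → 0 < B₃' → 0 < a₀ → 0 < a₁ →
      VariationalThm1RegSepCoP7MGB F 2 (floorGuard F ((11 * 4 + 3 * F.L) * F.L)) (lamDatum F) (dataSmall7PTopOf F 2) B₃ a₀ a₁ →
      Gauge9RegSepTopStepGB F 2 (fun ν K Ω => suppDomOfRecord F ν K Ω) (F.L ^ 3) (floorGuard F ((11 * 4 + 3 * F.L) * F.L)) (lamDatum F) (dataSmall7PTopOf F 2) B₃ B₃' a₀ a₁ →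
      ∃ γ₀ ε₀ ε₂₉ β' : ℝ, 0 < γ₀ ∧ 0 < ε₀ ∧ 0 < ε₂₉ ∧
        BetaLowerH (-β') γ₀ (betaOfRecord₁₃ F 2 (theta13OfThm1CCM F 2 3 ε₀ ε₂₉ B₃ B₃' a₀ a₁)) ∧
        BetaUpperH β' γ₀ (betaOfRecord₁₃ F 2 (theta13OfThm1CCM F 2 3 ε₀ ε₂₉ B₃ B₃' a₀ a₁))) :
    ∀ F : T4Family, F.m ≤ 3 → ∃ θ : Stage13HParams F 2, θ.Provisos₁₃SepCoPH F 2 ∧ (θ.ZhUnity F 2 ∧ θ.SlotsNondegenerate₁₃ F 2) ∧ θ.Admissible F 2 :=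
  Summit.QuantumFields.YangMills.Theorems.K0AllTorusOfStepTokensRCubeB.stub4_of_stubs123A hseam_holds h1 h2 h3A

/-- **HYPOTHESIS-FREE IN THE SEAM**: `K0AllTorusOfStepTokensRCubeB.record13SepCoPHBody_of_stubs12_jetsFreePair_allTorus` with its displayed Stage-2 seam `hseam` DISCHARGED (`hseam_holds`, `rfl` post-seam); every other hypothesis unchanged and still DISPLAYED.  CONDITIONAL on them; K0⁷ NOT closed; nothing of Bałaban asserted. [cite: Balaban1988Convergent, Thm 1 p.262, (2.1) p.254, (2.12)–(2.13) pp.256–257; Balaban1985Variational, Thm 1 (8)–(9) p.279, Prop. 8 p.304; Balaban1987RG1, Thm 1 p.259, §1 p.264] -/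
theorem record13SepCoPHBody_of_stubs12_jetsFreePair_allTorus_seamFree
    (h1 : ∀ F : T4Family, ∃ B₃ a₀ a₁ : ℝ, 2 * (F.L : ℝ) ^ 2 ≤ B₃ ∧ 0 < a₀ ∧ 0 < a₁ ∧
      Prop8RegSepTopStepGB F 2 (fun ν K Ω => suppDomOfRecord F ν K Ω) (floorGuard F ((11 * 4 + 3 * F.L) * F.L)) (lamDatum F) (dataSmall7PTopOf F 2) B₃ a₀ a₁)
    (h2 : ∀ F : T4Family, ∃ B₁ c₁ : ℝ, 0 ≤ B₁ ∧ 0 < c₁ ∧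
      (letI : CStarAlgebra (MatA 2) := {}; B8.Prop6Printed 4 (F.L : ℝ) B₁ c₁ (fun i : B8LeafModelZd.ZdIdx 4 F.L => zdCub (MatA 2) F.L i)))
    (h3J : ∀ (F : T4Family) (B₃ B₃' a₀ a₁ : ℝ), 2 * (F.L : ℝ) ^ 2 ≤ B₃ → 0 < B₃' → 0 < a₀ → 0 < a₁ →
      VariationalThm1RegSepCoP7MGB F 2 (floorGuard F ((11 * 4 + 3 * F.L) * F.L)) (lamDatum F) (dataSmall7PTopOf F 2) B₃ a₀ a₁ →
      Gauge9RegSepTopStepGB F 2 (fun ν K Ω => suppDomOfRecord F ν K Ω) (F.L ^ 3) (floorGuard F ((11 * 4 + 3 * F.L) * F.L)) (lamDatum F) (dataSmall7PTopOf F 2) B₃ B₃' a₀ a₁ →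
      ∃ ε₀ ε₂₉ : ℝ, 0 < ε₀ ∧ 0 < ε₂₉ ∧
        (letI := (theta13OfThm1CCM F 2 3 ε₀ ε₂₉ B₃ B₃' a₀ a₁).instVβ₁; letI := (theta13OfThm1CCM F 2 3 ε₀ ε₂₉ B₃ B₃' a₀ a₁).instVβ₂;
         letI := (theta13OfThm1CCM F 2 3 ε₀ ε₂₉ B₃ B₃' a₀ a₁).instιβ
         ∃ d A : ℝ, 0 ≤ d ∧
           OneLoopDrift d A (beta0OfMerged (betaMerged F (mergedTermFamilyMatT F 2 (TcanOfRecord F 2)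
             (chiFixed29 F 2 (theta13OfThm1CCM F 2 3 ε₀ ε₂₉ B₃ B₃' a₀ a₁).ν (theta13OfThm1CCM F 2 3 ε₀ ε₂₉ B₃ B₃' a₀ a₁).ε₂₉) (theta13OfThm1CCM F 2 3 ε₀ ε₂₉ B₃ B₃' a₀ a₁).εbg)
             (theta13OfThm1CCM F 2 3 ε₀ ε₂₉ B₃ B₃' a₀ a₁).ρ8 (theta13OfThm1CCM F 2 3 ε₀ ε₂₉ B₃ B₃' a₀ a₁).bV) (theta13OfThm1CCM F 2 3 ε₀ ε₂₉ B₃ B₃' a₀ a₁).v₀) ∧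
           ∃ γ₀ : ℝ, 0 < γ₀ ∧ γ₀ ≤ (theta13OfThm1CCM F 2 3 ε₀ ε₂₉ B₃ B₃' a₀ a₁).γ ∧
             AtSlopeCont
               (oneLoopSplit_betaOfMerged
                 (betaMerged F (mergedTermFamilyMatT F 2 (TcanOfRecord F 2)
                   (chiFixed29 F 2 (theta13OfThm1CCM F 2 3 ε₀ ε₂₉ B₃ B₃' a₀ a₁).ν (theta13OfThm1CCM F 2 3 ε₀ ε₂₉ B₃ B₃' a₀ a₁).ε₂₉) (theta13OfThm1CCM F 2 3 ε₀ ε₂₉ B₃ B₃' a₀ a₁).εbg)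
                   (theta13OfThm1CCM F 2 3 ε₀ ε₂₉ B₃ B₃' a₀ a₁).ρ8 (theta13OfThm1CCM F 2 3 ε₀ ε₂₉ B₃ B₃' a₀ a₁).bV)
                 (beta0OfMerged (betaMerged F (mergedTermFamilyMatT F 2 (TcanOfRecord F 2)
                   (chiFixed29 F 2 (theta13OfThm1CCM F 2 3 ε₀ ε₂₉ B₃ B₃' a₀ a₁).ν (theta13OfThm1CCM F 2 3 ε₀ ε₂₉ B₃ B₃' a₀ a₁).ε₂₉) (theta13OfThm1CCM F 2 3 ε₀ ε₂₉ B₃ B₃' a₀ a₁).εbg)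
                   (theta13OfThm1CCM F 2 3 ε₀ ε₂₉ B₃ B₃' a₀ a₁).ρ8 (theta13OfThm1CCM F 2 3 ε₀ ε₂₉ B₃ B₃' a₀ a₁).bV) (theta13OfThm1CCM F 2 3 ε₀ ε₂₉ B₃ B₃' a₀ a₁).v₀)
                 (theta13OfThm1CCM F 2 3 ε₀ ε₂₉ B₃ B₃' a₀ a₁).γ)
               γ₀ d)) :
    ∀ F : T4Family, ∃ θ : Stage13HParams F 2, θ.Provisos₁₃SepCoPH F 2 ∧ (θ.ZhUnity F 2 ∧ θ.SlotsNondegenerate₁₃ F 2) ∧ θ.Admissible F 2 :=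
  Summit.QuantumFields.YangMills.Theorems.K0AllTorusOfStepTokensRCubeB.record13SepCoPHBody_of_stubs12_jetsFreePair_allTorus hseam_holds h1 h2 h3J

/-! ## From `K0GenericCubeOfStepTokensRB` -/

/-- **HYPOTHESIS-FREE IN THE SEAM**: `K0GenericCubeOfStepTokensRB.record13SepCoPHBody_of_stub1_of_gauge9Supplier_of_absBetaBoxAt` with its displayed Stage-2 seam `hseam` DISCHARGED (`hseam_holds`, `rfl` post-seam); every other hypothesis unchanged and still DISPLAYED.  CONDITIONAL on them; K0⁷ NOT closed; nothing of Bałaban asserted. [cite: Balaban1988Convergent, Thm 1 p.262, (2.1) p.254, (2.12)–(2.13) pp.256–257; Balaban1985Variational, Thm 1 (8)–(9) p.279, Prop. 8 p.304; Balaban1987RG1, Thm 1 p.259, §1 p.264] -/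
theorem record13SepCoPHBody_of_stub1_of_gauge9Supplier_of_absBetaBoxAt_seamFree
    (h1 : ∀ F : T4Family, ∃ (c : ℕ) (B₃ a₀ a₁ : ℝ), 2 * (F.L : ℝ) ^ 2 ≤ B₃ ∧ 0 < a₀ ∧ 0 < a₁ ∧
      Prop8RegSepTopStepGB F 2 (fun ν K Ω => suppDomOfRecord F ν K Ω) (floorGuard F c) (lamDatum F) (dataSmall7PTopOf F 2) B₃ a₀ a₁)
    (hS : ∀ (F : T4Family) (c : ℕ) (B₃ a₀ a₁ : ℝ), 2 * (F.L : ℝ) ^ 2 ≤ B₃ → 0 < a₀ → 0 < a₁ →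
      Prop8RegSepTopStepGB F 2 (fun ν K Ω => suppDomOfRecord F ν K Ω) (floorGuard F c) (lamDatum F) (dataSmall7PTopOf F 2) B₃ a₀ a₁ →
      ∃ (j c' : ℕ) (B₉ a₁' : ℝ), c ≤ c' ∧ c' ≤ F.L ^ j ∧ 0 < B₉ ∧ 0 < a₁' ∧ a₁' ≤ a₁ ∧
        Gauge9RegSepTopStepGB F 2 (fun ν K Ω => suppDomOfRecord F ν K Ω) (F.L ^ j) (floorGuard F c') (lamDatum F) (dataSmall7PTopOf F 2) B₃ B₉ a₀ a₁')
    (h3A' : ∀ (F : T4Family) (j c : ℕ) (B₃ B₃' a₀ a₁ : ℝ), c ≤ F.L ^ j → 2 * (F.L : ℝ) ^ 2 ≤ B₃ → 0 < B₃' → 0 < a₀ → 0 < a₁ →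
      VariationalThm1RegSepCoP7MGB F 2 (floorGuard F c) (lamDatum F) (dataSmall7PTopOf F 2) B₃ a₀ a₁ →
      Gauge9RegSepTopStepGB F 2 (fun ν K Ω => suppDomOfRecord F ν K Ω) (F.L ^ j) (floorGuard F c) (lamDatum F) (dataSmall7PTopOf F 2) B₃ B₃' a₀ a₁ →
      ∃ γ₀ ε₀ ε₂₉ β' : ℝ, 0 < γ₀ ∧ 0 < ε₀ ∧ 0 < ε₂₉ ∧
        BetaLowerH (-β') γ₀ (betaOfRecord₁₃ F 2 (theta13OfThm1CCM F 2 j ε₀ ε₂₉ B₃ B₃' a₀ a₁)) ∧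
        BetaUpperH β' γ₀ (betaOfRecord₁₃ F 2 (theta13OfThm1CCM F 2 j ε₀ ε₂₉ B₃ B₃' a₀ a₁))) :
    ∀ F : T4Family, ∃ θ : Stage13HParams F 2, θ.Provisos₁₃SepCoPH F 2 ∧ (θ.ZhUnity F 2 ∧ θ.SlotsNondegenerate₁₃ F 2) ∧ θ.Admissible F 2 :=
  Summit.QuantumFields.YangMills.Theorems.K0GenericCubeOfStepTokensRB.record13SepCoPHBody_of_stub1_of_gauge9Supplier_of_absBetaBoxAt hseam_holds h1 hS h3A'

/-- **HYPOTHESIS-FREE IN THE SEAM**: `K0GenericCubeOfStepTokensRB.record13SepCoPHBody_of_stubs123A'` with its displayed Stage-2 seam `hseam` DISCHARGED (`hseam_holds`, `rfl` post-seam); every other hypothesis unchanged and still DISPLAYED.  CONDITIONAL on them; K0⁷ NOT closed; nothing of Bałaban asserted. [cite: Balaban1988Convergent, Thm 1 p.262, (2.1) p.254, (2.12)–(2.13) pp.256–257; Balaban1985Variational, Thm 1 (8)–(9) p.279, Prop. 8 p.304; Balaban1987RG1, Thm 1 p.259, §1 p.264] -/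
theorem record13SepCoPHBody_of_stubs123A_seamFree'
    (h1 : ∀ F : T4Family, ∃ (c : ℕ) (B₃ a₀ a₁ : ℝ), 2 * (F.L : ℝ) ^ 2 ≤ B₃ ∧ 0 < a₀ ∧ 0 < a₁ ∧
      Prop8RegSepTopStepGB F 2 (fun ν K Ω => suppDomOfRecord F ν K Ω) (floorGuard F c) (lamDatum F) (dataSmall7PTopOf F 2) B₃ a₀ a₁)
    (h2 : ∀ F : T4Family, ∃ B₁ c₁ : ℝ, 0 ≤ B₁ ∧ 0 < c₁ ∧
      (letI : CStarAlgebra (MatA 2) := {}; B8.Prop6Printed 4 (F.L : ℝ) B₁ c₁ (fun i : B8LeafModelZd.ZdIdx 4 F.L => zdCub (MatA 2) F.L i)))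
    (h3A' : ∀ (F : T4Family) (j c : ℕ) (B₃ B₃' a₀ a₁ : ℝ), c ≤ F.L ^ j → 2 * (F.L : ℝ) ^ 2 ≤ B₃ → 0 < B₃' → 0 < a₀ → 0 < a₁ →
      VariationalThm1RegSepCoP7MGB F 2 (floorGuard F c) (lamDatum F) (dataSmall7PTopOf F 2) B₃ a₀ a₁ →
      Gauge9RegSepTopStepGB F 2 (fun ν K Ω => suppDomOfRecord F ν K Ω) (F.L ^ j) (floorGuard F c) (lamDatum F) (dataSmall7PTopOf F 2) B₃ B₃' a₀ a₁ →
      ∃ γ₀ ε₀ ε₂₉ β' : ℝ, 0 < γ₀ ∧ 0 < ε₀ ∧ 0 < ε₂₉ ∧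
        BetaLowerH (-β') γ₀ (betaOfRecord₁₃ F 2 (theta13OfThm1CCM F 2 j ε₀ ε₂₉ B₃ B₃' a₀ a₁)) ∧
        BetaUpperH β' γ₀ (betaOfRecord₁₃ F 2 (theta13OfThm1CCM F 2 j ε₀ ε₂₉ B₃ B₃' a₀ a₁))) :
    ∀ F : T4Family, ∃ θ : Stage13HParams F 2, θ.Provisos₁₃SepCoPH F 2 ∧ (θ.ZhUnity F 2 ∧ θ.SlotsNondegenerate₁₃ F 2) ∧ θ.Admissible F 2 :=
  Summit.QuantumFields.YangMills.Theorems.K0GenericCubeOfStepTokensRB.record13SepCoPHBody_of_stubs123A' hseam_holds h1 h2 h3A'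

/-! ## From `K0AllTorusOfStepTokensRFloorB` -/

/-- **HYPOTHESIS-FREE IN THE SEAM**: `K0AllTorusOfStepTokensRFloorB.record13SepCoPHBody_of_stub1R_of_gauge9SupplierR_of_absBetaBoxAtR` with its displayed Stage-2 seam `hseam` DISCHARGED (`hseam_holds`, `rfl` post-seam); every other hypothesis unchanged and still DISPLAYED.  CONDITIONAL on them; K0⁷ NOT closed; nothing of Bałaban asserted. [cite: Balaban1988Convergent, Thm 1 p.262, (2.1) p.254, (2.12)–(2.13) pp.256–257; Balaban1985Variational, Thm 1 (8)–(9) p.279, Prop. 8 p.304; Balaban1987RG1, Thm 1 p.259, §1 p.264] -/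
theorem record13SepCoPHBody_of_stub1R_of_gauge9SupplierR_of_absBetaBoxAtR_seamFree
    {DatF : (F : T4Family) → TopData F 2}
    (hDat : ∀ (F : T4Family) (θ : Stage13Params F 2) (p : B12.RunParams) (n : ℕ) (s : SeqOfRecord F θ.ν θ.τ9.M (gOfRecord₁₃ F 2 θ p) p.K n) (δ : ℕ → ℝ) (W : MSField (F.P p.K) (SU 2)),
      n ≤ p.K → PartCompat₁₃ F 2 θ p n →
      Sect2.DataSmall7PTop (avOfRecord F 2 p.K) s.Ω (suppDomOfRecord F θ.ν p.K s.Ω) n δ W → DatF F p.K s.Ω (suppDomOfRecord F θ.ν p.K s.Ω) n δ W)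
    (h1R : ∀ F : T4Family, ∃ (c : ℕ) (B₃ a₀ a₁ : ℝ), 2 * (F.L : ℝ) ^ 2 ≤ B₃ ∧ 0 < a₀ ∧ 0 < a₁ ∧
      Prop8RegSepTopStepGB F 2 (fun ν K Ω => suppDomOfRecord F ν K Ω) (floorGuard F c) (lamDatum F) (DatF F) B₃ a₀ a₁)
    (hSR : ∀ (F : T4Family) (c : ℕ) (B₃ a₀ a₁ : ℝ), 2 * (F.L : ℝ) ^ 2 ≤ B₃ → 0 < a₀ → 0 < a₁ →
      Prop8RegSepTopStepGB F 2 (fun ν K Ω => suppDomOfRecord F ν K Ω) (floorGuard F c) (lamDatum F) (DatF F) B₃ a₀ a₁ →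
      ∃ (j c' : ℕ) (B₉ a₁' : ℝ), c ≤ c' ∧ c' ≤ F.L ^ j ∧ 0 < B₉ ∧ 0 < a₁' ∧ a₁' ≤ a₁ ∧
        Gauge9RegSepTopStepGB F 2 (fun ν K Ω => suppDomOfRecord F ν K Ω) (F.L ^ j) (floorGuard F c') (lamDatum F) (DatF F) B₃ B₉ a₀ a₁')
    (h3A'R : ∀ (F : T4Family) (j c : ℕ) (B₃ B₃' a₀ a₁ : ℝ), c ≤ F.L ^ j → 2 * (F.L : ℝ) ^ 2 ≤ B₃ → 0 < B₃' → 0 < a₀ → 0 < a₁ →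
      VariationalThm1RegSepCoP7MGB F 2 (floorGuard F c) (lamDatum F) (DatF F) B₃ a₀ a₁ →
      Gauge9RegSepTopStepGB F 2 (fun ν K Ω => suppDomOfRecord F ν K Ω) (F.L ^ j) (floorGuard F c) (lamDatum F) (DatF F) B₃ B₃' a₀ a₁ →
      ∃ γ₀ ε₀ ε₂₉ β' : ℝ, 0 < γ₀ ∧ 0 < ε₀ ∧ 0 < ε₂₉ ∧
        BetaLowerH (-β') γ₀ (betaOfRecord₁₃ F 2 (theta13OfThm1CCM F 2 j ε₀ ε₂₉ B₃ B₃' a₀ a₁)) ∧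
        BetaUpperH β' γ₀ (betaOfRecord₁₃ F 2 (theta13OfThm1CCM F 2 j ε₀ ε₂₉ B₃ B₃' a₀ a₁))) :
    ∀ F : T4Family, ∃ θ : Stage13HParams F 2, θ.Provisos₁₃SepCoPH F 2 ∧ (θ.ZhUnity F 2 ∧ θ.SlotsNondegenerate₁₃ F 2) ∧ θ.Admissible F 2 :=
  Summit.QuantumFields.YangMills.Theorems.K0AllTorusOfStepTokensRFloorB.record13SepCoPHBody_of_stub1R_of_gauge9SupplierR_of_absBetaBoxAtR hDat hseam_holds h1R hSR h3A'R

/-! ## From `K0V23Stub3ComparabilitySuppliers` -/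

/-- **HYPOTHESIS-FREE IN THE SEAM**: `K0V23Stub3ComparabilitySuppliers.k0Body_of_twoComparableZB_byName` with its displayed Stage-2 seam `hseam` DISCHARGED (`hseam_holds`, `rfl` post-seam); every other hypothesis unchanged and still DISPLAYED.  CONDITIONAL on them; K0⁷ NOT closed; nothing of Bałaban asserted. [cite: Balaban1988Convergent, Thm 1 p.262, (2.1) p.254, (2.12)–(2.13) pp.256–257; Balaban1985Variational, Thm 1 (8)–(9) p.279, Prop. 8 p.304; Balaban1987RG1, Thm 1 p.259, §1 p.264] -/
theorem k0Body_of_twoComparableZB_byName_seamFree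
    (h2P : ∀ F : T4Family, ∃ (ρ₀ : ℕ) (B₁ c₁ : ℝ), 1 ≤ ρ₀ ∧ 0 ≤ B₁ ∧ 0 < c₁ ∧
      (letI : CStarAlgebra (MatA 2) := {}; B8.Prop6Printed 4 (F.L : ℝ) B₁ c₁ (fun i : ZdIdx 4 F.L => zdCubP (MatA 2) F.L ρ₀ i)))
    (comp : ∀ (F : T4Family) (a₀ : ℝ), 0 < a₀ → ∃ γ₀ ε₂₉ : ℝ, 0 < γ₀ ∧ 0 < ε₂₉ ∧ ∀ (j : ℕ) (ε₀ B₃ B₃' a₁ : ℝ),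
      ∀ (n : ℕ) (gs : ℕ → ℝ), RGEqH n (betaOfRecord₁₃ F 2 (theta13OfThm1CCMWZB F 2 j (1 / 2) a₀ ε₀ ε₂₉ B₃ B₃' a₀ a₁ (fun _ _ => 0) (fun _ _ => 0))) gs → Step.InInterval γ₀ n gs →
        ∀ m, m < n → gs m ≤ 2 * gs (m + 1) ∧ gs (m + 1) ≤ 2 * gs m) :
    ∀ F : T4Family, ∃ θ : Stage13HParams F 2, θ.Provisos₁₃SepCoPH F 2 ∧ (θ.ZhUnity F 2 ∧ θ.SlotsNondegenerate₁₃ F 2) ∧ θ.Admissible F 2 :=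
  Summit.QuantumFields.YangMills.Theorems.K0V23Stub3ComparabilitySuppliers.k0Body_of_twoComparableZB_byName hseam_holds h2P comp

/-- **HYPOTHESIS-FREE IN THE SEAM**: `K0V23Stub3ComparabilitySuppliers.k0Body_of_seam_of_twoComparableZB` with its displayed Stage-2 seam `hseam` DISCHARGED (`hseam_holds`, `rfl` post-seam); every other hypothesis unchanged and still DISPLAYED.  CONDITIONAL on them; K0⁷ NOT closed; nothing of Bałaban asserted. [cite: Balaban1988Convergent, Thm 1 p.262, (2.1) p.254, (2.12)–(2.13) pp.256–257; Balaban1985Variational, Thm 1 (8)–(9) p.279, Prop. 8 p.304; Balaban1987RG1, Thm 1 p.259, §1 p.264] -/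
theorem k0Body_of_seam_of_twoComparableZB_seamFree
    (comp : ∀ (F : T4Family) (a₀ : ℝ), 0 < a₀ → ∃ γ₀ ε₂₉ : ℝ, 0 < γ₀ ∧ 0 < ε₂₉ ∧ ∀ (j : ℕ) (ε₀ B₃ B₃' a₁ : ℝ),
      ∀ (n : ℕ) (gs : ℕ → ℝ), RGEqH n (betaOfRecord₁₃ F 2 (theta13OfThm1CCMWZB F 2 j (1 / 2) a₀ ε₀ ε₂₉ B₃ B₃' a₀ a₁ (fun _ _ => 0) (fun _ _ => 0))) gs → Step.InInterval γ₀ n gs →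
        ∀ m, m < n → gs m ≤ 2 * gs (m + 1) ∧ gs (m + 1) ≤ 2 * gs m) :
    ∀ F : T4Family, ∃ θ : Stage13HParams F 2, θ.Provisos₁₃SepCoPH F 2 ∧ (θ.ZhUnity F 2 ∧ θ.SlotsNondegenerate₁₃ F 2) ∧ θ.Admissible F 2 :=
  Summit.QuantumFields.YangMills.Theorems.K0V23Stub3ComparabilitySuppliers.k0Body_of_seam_of_twoComparableZB hseam_holds comp

end Summit.QuantumFields.YangMills.Theorems.K0SeamFreeBodies

end
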